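import Summits.RiemannHypothesis.RiemannHypothesis.Theses.SignCone
import Summits.RiemannHypothesis.RiemannHypothesis.Theorems.SignConeUnitSlackReduction

/-!
# Route-level corollaries of the unit-slack reduction (route `SignCone`, item stmt-RiemannHypothesis-16302)

Three one-line consequences of `neg_re_apply_zero_le_re_weilArchPolar_of_fakeWeight_unitSlack`
(`SignConeUnitSlackReduction.lean`), typed against the ROUTE DECLARATIONS of `Theses/SignCone.lean`:

* `signConeInequality_of_coneMagnificationHyp` — the antecedent of the crux `ConeMagnification`
  (at every cutoff `a > 0` some non-negative integer-supported weight `c_a`, `c_a 1 = 0`, whose fake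
  Weil form `W_ar - P_{c_a}` has unit slack on all Weil tests supported in `[-a, a]`) implies the
  route's target `SignConeInequality`.  Together with the crux `SignConeDuality` (the converse) the
  two statements are EQUIVALENT, so the route's `X` is exactly "unit-slack fake weights exist at every
  cutoff";
* `signConeOscillatory_of_coneMagnificationHyp` — hence it implies the crux `SignConeOscillatory`;
* `coneMagnification_of_imp` — `(SignConeInequality → Summit.RiemannHypothesis) → ConeMagnification`:
  the magnification crux is implied by (and, given `SignConeDuality`, equivalent to) "the target implies
  the summit".

Support lemmas (`--supports`); they close nothing.
-/

noncomputable section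

-- the summit-side namespace `Summit.RiemannHypothesis.RiemannHypothesis.…` (D-0017: Sub = Summit) repeats a component
set_option linter.dupNamespace false

open scoped BigOperators
open MeasureTheory Set

namespace Summit.RiemannHypothesis.RiemannHypothesis.Theorems.SignCone

open Literature.NumberTheory.LFunctions
open Summit.RiemannHypothesis.RiemannHypothesis.Theses.SignCone

/-- **The antecedent of `ConeMagnification` implies `SignConeInequality`** (easy converse of the crux
`SignConeDuality`, at every cutoff): unit-slack fake weights at every cutoff give the unit-slack
sign-cone inequality on the whole sign cone. The hypothesis is the antecedent of the route decl
`ConeMagnification`, verbatim. [folklore] -/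
theorem signConeInequality_of_coneMagnificationHyp
    (h : ∀ a : ℝ, 0 < a → ∃ c : ℕ → ℝ, (∀ n, 0 ≤ c n) ∧ c 1 = 0 ∧ ∀ g : ℝ → ℂ,
      (ContDiff ℝ ((⊤ : ℕ∞) : WithTop ℕ∞) g ∧ HasCompactSupport g) → tsupport g ⊆ Set.Icc (-a) a →
      let G : ℝ → ℂ := MeasureTheory.convolution g (fun u => (starRingEnd ℂ) (g (-u)))
        (ContinuousLinearMap.mul ℂ ℂ) MeasureTheory.MeasureSpace.volume;
      let M : ℂ → ℂ := fun s => ∫ u : ℝ, G u * Complex.exp ((s - 1 / 2) * u);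
      -(∫ t, ‖g t‖ ^ 2) ≤ (M 0 + M 1 + ((1 / (2 * Real.pi) : ℂ) * (∫ t : ℝ, M (1 / 2 + t * Complex.I) *
        ((Complex.digamma (1 / 4 + t / 2 * Complex.I)).re : ℂ)) - G 0 * (Real.log Real.pi : ℂ)) -
        ∑' n : ℕ, ((c n : ℝ) : ℂ) / (Real.sqrt n : ℂ) * (G (Real.log n) + G (-Real.log n))).re) :
    SignConeInequality := by
  intro a ha k g hg F hn M
  obtain ⟨c, hc, -, hcW⟩ := h a ha
  show -(F 0).re ≤ (weilPolarTerm F + weilArchTerm F).re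
  exact neg_re_apply_zero_le_re_weilArchPolar_of_fakeWeight_unitSlack (b := a) hc
    (fun g' hg' hs' => hcW g' hg' hs') (g := g) (F := F) rfl (fun i => (hg i).1) (fun i => (hg i).2) hn

/-- Hence the antecedent of `ConeMagnification` implies the crux `SignConeOscillatory`. [folklore] -/
theorem signConeOscillatory_of_coneMagnificationHyp
    (h : ∀ a : ℝ, 0 < a → ∃ c : ℕ → ℝ, (∀ n, 0 ≤ c n) ∧ c 1 = 0 ∧ ∀ g : ℝ → ℂ,
      (ContDiff ℝ ((⊤ : ℕ∞) : WithTop ℕ∞) g ∧ HasCompactSupport g) → tsupport g ⊆ Set.Icc (-a) a →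
      let G : ℝ → ℂ := MeasureTheory.convolution g (fun u => (starRingEnd ℂ) (g (-u)))
        (ContinuousLinearMap.mul ℂ ℂ) MeasureTheory.MeasureSpace.volume;
      let M : ℂ → ℂ := fun s => ∫ u : ℝ, G u * Complex.exp ((s - 1 / 2) * u);
      -(∫ t, ‖g t‖ ^ 2) ≤ (M 0 + M 1 + ((1 / (2 * Real.pi) : ℂ) * (∫ t : ℝ, M (1 / 2 + t * Complex.I) *
        ((Complex.digamma (1 / 4 + t / 2 * Complex.I)).re : ℂ)) - G 0 * (Real.log Real.pi : ℂ)) -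
        ∑' n : ℕ, ((c n : ℝ) : ℂ) / (Real.sqrt n : ℂ) * (G (Real.log n) + G (-Real.log n))).re) :
    SignConeOscillatory :=
  fun a ha k g hg hn _ => signConeInequality_of_coneMagnificationHyp h a ha k g hg hn

/-- **`(SignConeInequality → RH) → ConeMagnification`**: since the antecedent of `ConeMagnification`
already yields `SignConeInequality`, the magnification crux follows from "the route's target implies
the summit" (and, given `SignConeDuality`, is equivalent to it). [folklore] -/
theorem coneMagnification_of_imp (h : SignConeInequality → Summit.RiemannHypothesis) :
    ConeMagnification :=
  fun hc => h (signConeInequality_of_coneMagnificationHyp hc)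

/-- **Unit-slack Weil positivity on every cone gives the crux**: if `-‖g‖₂² ≤ Re Q(g)` for every Weil
test `g` supported in `[-a, a]` (every `a > 0`) — the `c = Λ` instance of the antecedent of
`ConeMagnification`, in form strictly weaker than `WeilPositivity` — then `SignConeOscillatory`. [folklore] -/
theorem signConeOscillatory_of_unitSlackWeilPositivity
    (h : ∀ a : ℝ, 0 < a → ∀ g : ℝ → ℂ, IsWeilTest g → tsupport g ⊆ Icc (-a) a →
      -(∫ t : ℝ, ‖g t‖ ^ 2) ≤ (weilQuadratic g).re) :
    SignConeOscillatory := by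
  intro a ha k g hg F hn _hosc M
  show -(F 0).re ≤ (weilPolarTerm F + weilArchTerm F).re
  refine neg_re_apply_zero_le_re_weilArchPolar_of_fakeWeight_unitSlack (b := a)
    (c := fun n => ArithmeticFunction.vonMangoldt n) (fun _ => ArithmeticFunction.vonMangoldt_nonneg)
    (fun g' hg' hs' => ?_) (g := g) (F := F) rfl (fun i => (hg i).1) (fun i => (hg i).2) hn
  have e : weilPolarTerm (weilConv g' (weilReflect g')) + weilArchTerm (weilConv g' (weilReflect g')) -
      ∑' n : ℕ, ((ArithmeticFunction.vonMangoldt n : ℝ) : ℂ) / (Real.sqrt n : ℂ) *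
        (weilConv g' (weilReflect g') (Real.log n) + weilConv g' (weilReflect g') (-Real.log n)) =
      weilQuadratic g' := by
    unfold weilQuadratic weilFunctional weilPrimeTerm
    ring
  rw [e]
  exact h a ha g' hg' hs'

end Summit.RiemannHypothesis.RiemannHypothesis.Theorems.SignCone

end
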